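import Mathlib.Data.List.GetD
import Mathlib.Data.List.Nodup
import Mathlib.Data.List.Range
import Literature.ModelTheory.FiniteModelTheory.BGSPrograms
import HarnessLib

/-!
# Simulating BGS programs in polynomial time, I: hash-consed tables of hereditarily finite sets

Topic `Literature/ModelTheory/FiniteModelTheory`; first support file of the discharge of the named
fact `Literature.ModelTheory.FiniteModelTheory.CPTCardInPTIME` (`CPTCardProgram.lean`:
Blass–Gurevich–Shelah 1999, §5.2 Theorem 1 — a PTime bounded BGS program is simulated by a
polynomial-time Turing machine; with `Card`, Blass–Gurevich–Shelah 2002, §2). The simulating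
machine (files `CPTCardPTIME*.lean`) is written, as everywhere in the tree, as a first-order
functional program on lists of naturals which the typed polynomial-time algebra `CodeFP` runs on
codes. This file is its DATA STRUCTURE: the objects of `HF(Fin n)` met during a run are kept in a
TABLE `T : List (List ℕ)` —

* index `i < n` is the atom `i` (its entry is a dummy `[]`); index `i ≥ n` is the SET whose members
  are the objects at the indices listed in `T[i]` (`elems`, `val`; the value `val n T i : HF (Fin n)`
  is defined by well-founded recursion, reading only indices `< i`, so that it is stable under
  appending entries, `val_of_agree`);
* `Canon n T` — the table is CANONICAL: it starts with the atoms, `∅ = 0 = false` at index `n` and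
  `{∅} = 1 = true` at index `n + 1`, entries point strictly downwards and have no repetitions, and
  `val` is INJECTIVE on `[0, |T|)` (hash-consing): equality of objects is equality of indices,
  membership is membership of indices (`mem_elems_iff`), the number of members is the length of the
  entry (`card_members_val`);
* `mkSet n T l` — the index of the set `{val k : k ∈ l}`, found by extensional comparison of index
  lists (`sameSet`) or else APPENDED (`mkSet_spec`: canonicity is preserved, old indices keep their
  values); `initTab n` (atoms, `0`, `1`); `boolIdx`.

Nothing here is specific to programs; the evaluator is `CPTCardPTIMEEval.lean`.

## References

* A. Blass, Y. Gurevich, S. Shelah, *Choiceless polynomial time*, Ann. Pure Appl. Logic 100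
  (1999) 141–187 = arXiv:math/9705225, §5.2, Theorem 1 (simulation by a PTime Turing machine).
* A. Blass, Y. Gurevich, S. Shelah, *On polynomial time computation over unordered structures*,
  J. Symbolic Logic 67 (2002), §2 (the same with `Card`).
* A. V. Aho, J. E. Hopcroft, J. D. Ullman, *The Design and Analysis of Computer Algorithms*, 1974,
  §4 (representing sets; hash-consing of shared subterms is folklore).
-/

noncomputable section

namespace Literature.ModelTheory.FiniteModelTheory.BGS.Sim

variable {n : ℕ}

/-! ### Tables and the objects they denote -/

/-- The member indices of the object at index `i` of the table `T` over `n` atoms: none for an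
atom (`i < n`), the entry `T[i]` for a set (empty past the end of the table). [folklore] -/
def elems (n : ℕ) (T : List (List ℕ)) (i : ℕ) : List ℕ :=
  if i < n then [] else T.getD i []

/-- **The object denoted by index `i`** of the table `T` over the atoms `Fin n`: the atom `i` if
`i < n`, otherwise the set of the objects denoted by the indices `< i` listed in `T[i]`
(well-founded recursion on `i`; indices `≥ i` in an entry — absent in canonical tables — are
ignored, which makes the value depend on `T[0..i]` only). [folklore] -/
def val (n : ℕ) (T : List (List ℕ)) : ℕ → HF (Fin n)
  | i =>
    if h : i < n then HF.atom ⟨i, h⟩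
    else HF.ofList (((T.getD i []).filter (· < i)).attach.map fun k => val n T k.1)
termination_by i => i
decreasing_by
  have hk := (List.mem_filter.mp k.2).2
  simpa using hk

/-- Unfolding `val` at an atom index. [folklore] -/
theorem val_of_lt (T : List (List ℕ)) {i : ℕ} (h : i < n) : val n T i = HF.atom ⟨i, h⟩ := by
  rw [val, dif_pos h]

/-- Unfolding `val` at a set index. [folklore] -/
theorem val_of_le (T : List (List ℕ)) {i : ℕ} (h : n ≤ i) :
    val n T i = HF.ofList (((T.getD i []).filter (· < i)).map (val n T)) := by
  rw [val, dif_neg (Nat.not_lt.mpr h), List.attach_map_val]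

/-- Atom indices denote atoms, set indices denote sets. [folklore] -/
theorem isAtom_val_iff (T : List (List ℕ)) (i : ℕ) : (val n T i).IsAtom ↔ i < n := by
  constructor
  · intro h
    by_contra hi
    rw [val_of_le T (Nat.not_lt.mp hi)] at h
    exact HF.not_isAtom_ofList _ h
  · intro h
    rw [val_of_lt T h]
    exact HF.isAtom_atom _

/-- Membership in the value of a set index. [folklore] -/
theorem mem_val_iff (T : List (List ℕ)) {i : ℕ} (h : n ≤ i) (x : HF (Fin n)) :
    x ∈ val n T i ↔ ∃ k ∈ T.getD i [], k < i ∧ val n T k = x := by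
  rw [val_of_le T h, HF.mem_ofList, List.mem_map]
  simp only [List.mem_filter, decide_eq_true_eq, and_assoc]

/-- **Stability**: the value at `i` depends only on the entries at indices `≤ i`; in particular
two tables that agree below `m` have the same values below `m`. [folklore] -/
theorem val_of_agree {T T' : List (List ℕ)} {m : ℕ} (hTT' : ∀ j < m, T.getD j [] = T'.getD j [])
    {i : ℕ} (hi : i < m) : val n T i = val n T' i := by
  induction i using Nat.strong_induction_on with
  | _ i ih =>
    by_cases h : i < n
    · rw [val_of_lt T h, val_of_lt T' h]
    · replace h : n ≤ i := Nat.le_of_not_lt h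
      rw [val_of_le T h, val_of_le T' h, hTT' i hi]
      congr 1
      refine List.map_congr_left fun k hk => ?_
      have hki : k < i := by simpa using (List.mem_filter.mp hk).2
      exact ih k hki (lt_trans hki hi)

/-- Appending entries does not change the values of the old indices. [folklore] -/
theorem val_append (T T' : List (List ℕ)) {i : ℕ} (hi : i < T.length) :
    val n (T ++ T') i = val n T i :=
  (val_of_agree (T := T) (T' := T ++ T') (m := T.length)
    (fun j hj => by rw [List.getD_append _ _ _ _ hj]) hi).symm

/-! ### Canonical tables -/

/-- **Canonical tables** over `n` atoms: at least the `n + 2` initial entries; every set entry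
lists indices strictly below its own index (well-foundedness) without repetition; distinct
indices denote distinct objects (hash-consing); index `n` is `∅ = 0 = false` and index `n + 1` is
`{∅} = 1 = true`. [folklore] -/
structure Canon (n : ℕ) (T : List (List ℕ)) : Prop where
  /-- the atoms, `0` and `1` are present -/
  le_length : n + 2 ≤ T.length
  /-- entries point strictly downwards -/
  wf : ∀ i, n ≤ i → i < T.length → ∀ k ∈ T.getD i [], k < i
  /-- entries have no repetitions -/
  nodup : ∀ i, n ≤ i → i < T.length → (T.getD i []).Nodup
  /-- distinct indices denote distinct objects -/
  inj : ∀ i j, i < T.length → j < T.length → val n T i = val n T j → i = j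
  /-- index `n` is the empty set -/
  entry_n : T.getD n [] = []
  /-- index `n + 1` is `{∅}` -/
  entry_n_succ : T.getD (n + 1) [] = [n]

namespace Canon

variable {T : List (List ℕ)}

/-- In a canonical table the value of a set index is the set of the values of its entry.
[folklore] -/
theorem val_eq (hT : Canon n T) {i : ℕ} (h : n ≤ i) (hi : i < T.length) :
    val n T i = HF.ofList ((T.getD i []).map (val n T)) := by
  rw [val_of_le T h, List.filter_eq_self.mpr fun k hk => decide_eq_true (hT.wf i h hi k hk)]

/-- Past the end of the table (and at index `n`) the value is `∅`. [folklore] -/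
theorem val_of_length_le (T : List (List ℕ)) {i : ℕ} (h : n ≤ i) (hi : T.length ≤ i) :
    val n T i = ∅ := by
  rw [val_of_le T h, List.getD_eq_default _ _ hi]
  exact HF.eq_empty_of_forall_not_mem (HF.not_isAtom_ofList _) fun x hx => by simp at hx

/-- Index `n` denotes `∅ = false`. [folklore] -/
theorem val_n (hT : Canon n T) : val n T n = ∅ := by
  rw [hT.val_eq le_rfl (by have := hT.le_length; omega), hT.entry_n]
  exact HF.eq_empty_of_forall_not_mem (HF.not_isAtom_ofList _) fun x hx => by simp at hx

/-- Index `n + 1` denotes `{∅} = 1 = true`. [folklore] -/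
theorem val_n_succ (hT : Canon n T) : val n T (n + 1) = HF.ofBool true := by
  rw [hT.val_eq (Nat.le_succ n) (by have := hT.le_length; omega), hT.entry_n_succ,
    List.map_singleton, hT.val_n, HF.ofBool_true]
  refine HF.ext (HF.not_isAtom_ofList _) (HF.not_isAtom_ordinal 1) fun x => ?_
  rw [HF.mem_ofList, List.mem_singleton, HF.mem_ordinal_iff]
  constructor
  · rintro rfl
    exact ⟨0, Nat.zero_lt_one, rfl⟩
  · rintro ⟨m, hm, rfl⟩
    obtain rfl : m = 0 := Nat.lt_one_iff.mp hm
    rfl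

/-- The index of the truth value `b`: `n + 1` for `true`, `n` for `false`. [folklore] -/
def _root_.Literature.ModelTheory.FiniteModelTheory.BGS.Sim.boolIdx (n : ℕ) (b : Bool) : ℕ :=
  if b then n + 1 else n

/-- `boolIdx` denotes `ofBool`. [folklore] -/
theorem val_boolIdx (hT : Canon n T) (b : Bool) : val n T (boolIdx n b) = HF.ofBool b := by
  cases b
  · exact hT.val_n
  · exact hT.val_n_succ

/-- `boolIdx` is a valid index. [folklore] -/
theorem boolIdx_lt_length (hT : Canon n T) (b : Bool) : boolIdx n b < T.length := by
  have := hT.le_length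
  cases b <;> simp [boolIdx] <;> omega

/-- In a canonical table, an index denotes `∅` iff it is `n` (among valid indices). [folklore] -/
theorem val_eq_empty_iff (hT : Canon n T) {i : ℕ} (hi : i < T.length) : val n T i = ∅ ↔ i = n := by
  refine ⟨fun h => hT.inj i n hi (by have := hT.le_length; omega) (h.trans hT.val_n.symm),
    fun h => h ▸ hT.val_n⟩

/-- In a canonical table, an index denotes `ofBool b` iff it is `boolIdx n b`. [folklore] -/
theorem val_eq_ofBool_iff (hT : Canon n T) {i : ℕ} (hi : i < T.length) (b : Bool) :
    val n T i = HF.ofBool b ↔ i = boolIdx n b :=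
  ⟨fun h => hT.inj i _ hi (hT.boolIdx_lt_length b) (h.trans (hT.val_boolIdx b).symm),
    fun h => h ▸ hT.val_boolIdx b⟩

/-- Atom indices. [folklore] -/
theorem val_atom (T : List (List ℕ)) (a : Fin n) : val n T a = HF.atom a :=
  val_of_lt T a.2

/-- **Membership is membership of indices**: for a valid index `i`, `k ∈ elems n T i` iff `k` is a
valid index whose value is a member of the value of `i`. [folklore] -/
theorem mem_elems_iff (hT : Canon n T) {i : ℕ} (hi : i < T.length) (k : ℕ) :
    k ∈ elems n T i ↔ k < T.length ∧ val n T k ∈ val n T i := by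
  unfold elems
  split_ifs with h
  · simp only [List.not_mem_nil, false_iff, not_and]
    intro _ hk
    rw [val_of_lt T h] at hk
    exact HF.not_mem_atom _ _ hk
  · replace h : n ≤ i := Nat.le_of_not_lt h
    rw [hT.val_eq h hi]
    simp only [HF.mem_ofList, List.mem_map]
    constructor
    · intro hk
      exact ⟨(hT.wf i h hi k hk).trans hi, k, hk, rfl⟩
    · rintro ⟨hk, k', hk', hkk'⟩
      have hk'i := hT.wf i h hi k' hk'
      rwa [← hT.inj k' k (hk'i.trans hi) hk hkk']

/-- Members of a valid index are valid indices below it. [folklore] -/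
theorem lt_of_mem_elems (hT : Canon n T) {i : ℕ} (hi : i < T.length) {k : ℕ} (hk : k ∈ elems n T i) :
    k < i := by
  unfold elems at hk
  split_ifs at hk with h
  · simp at hk
  · exact hT.wf i (Nat.not_lt.mp h) hi k hk

/-- The entry of a valid index has no repetitions. [folklore] -/
theorem nodup_elems (hT : Canon n T) {i : ℕ} (hi : i < T.length) : (elems n T i).Nodup := by
  unfold elems
  split_ifs with h
  · exact List.nodup_nil
  · exact hT.nodup i (Nat.not_lt.mp h) hi

/-- The value of a valid index is the set of the values of its `elems` (an atom having none).
[folklore] -/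
theorem mem_val_iff_elems (hT : Canon n T) {i : ℕ} (hi : i < T.length) (x : HF (Fin n)) :
    x ∈ val n T i ↔ ∃ k ∈ elems n T i, val n T k = x := by
  constructor
  · intro hx
    by_cases h : i < n
    · rw [val_of_lt T h] at hx
      exact (HF.not_mem_atom _ _ hx).elim
    · replace h : n ≤ i := Nat.le_of_not_lt h
      rw [hT.val_eq h hi, HF.mem_ofList, List.mem_map] at hx
      obtain ⟨k, hk, rfl⟩ := hx
      refine ⟨k, ?_, rfl⟩
      unfold elems
      rwa [if_neg (Nat.not_lt.mpr h)]
  · rintro ⟨k, hk, rfl⟩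
    exact ((hT.mem_elems_iff hi k).mp hk).2

/-- **Counting members is measuring the entry**: the number of members of the value of a valid
index is the length of its `elems`. [folklore] -/
theorem card_members_val (hT : Canon n T) {i : ℕ} (hi : i < T.length) :
    (val n T i).members.card = (elems n T i).length := by
  classical
  have hset : (val n T i).members = ((elems n T i).map (val n T)).toFinset := by
    ext x
    rw [HF.mem_members, hT.mem_val_iff_elems hi, List.mem_toFinset, List.mem_map]
  rw [hset, List.toFinset_card_of_nodup, List.length_map]
  refine (List.nodup_map_iff_inj_on (hT.nodup_elems hi)).mpr fun k hk k' hk' h => ?_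
  exact hT.inj k k' ((hT.lt_of_mem_elems hi hk).trans hi) ((hT.lt_of_mem_elems hi hk').trans hi) h

end Canon

/-! ### Duplicate removal and extensional comparison of index lists -/

/-- The step of `dedupKeep`. [folklore] -/
def dedupStep (acc : List ℕ) (a : ℕ) : List ℕ := if a ∈ acc then acc else acc ++ [a]

/-- Removing repetitions, keeping first occurrences (a left fold, the form `CodeFP` runs).
[folklore] -/
def dedupKeep (l : List ℕ) : List ℕ := l.foldl dedupStep []

/-- The dedup fold from a repetition-free accumulator: no repetitions, members = old ∪ new,
length grows by at most the input length. [folklore] -/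
theorem foldl_dedupStep (l acc : List ℕ) (hacc : acc.Nodup) :
    (l.foldl dedupStep acc).Nodup ∧ (∀ x, x ∈ l.foldl dedupStep acc ↔ x ∈ acc ∨ x ∈ l) ∧
      (l.foldl dedupStep acc).length ≤ acc.length + l.length := by
  induction l generalizing acc with
  | nil => exact ⟨hacc, fun x => by simp, by simp⟩
  | cons a l ih =>
    rw [List.foldl_cons]
    by_cases ha : a ∈ acc
    · have hstep : dedupStep acc a = acc := if_pos ha
      rw [hstep]
      obtain ⟨h1, h2, h3⟩ := ih acc hacc
      refine ⟨h1, fun x => ?_, ?_⟩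
      · rw [h2, List.mem_cons]
        constructor
        · rintro (h | h)
          · exact Or.inl h
          · exact Or.inr (Or.inr h)
        · rintro (h | rfl | h)
          · exact Or.inl h
          · exact Or.inl ha
          · exact Or.inr h
      · simp only [List.length_cons]; omega
    · have hstep : dedupStep acc a = acc ++ [a] := if_neg ha
      rw [hstep]
      have hacc' : (acc ++ [a]).Nodup := by
        rw [List.nodup_append]
        exact ⟨hacc, List.nodup_singleton a, fun x hx y hy => by
          rw [List.mem_singleton] at hy; rintro rfl; exact ha (hy ▸ hx)⟩
      obtain ⟨h1, h2, h3⟩ := ih (acc ++ [a]) hacc'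
      refine ⟨h1, fun x => ?_, ?_⟩
      · rw [h2, List.mem_append, List.mem_singleton, List.mem_cons, or_assoc]
      · simp only [List.length_append, List.length_cons, List.length_nil] at h3 ⊢; omega

/-- `dedupKeep l` has no repetitions. [folklore] -/
theorem nodup_dedupKeep (l : List ℕ) : (dedupKeep l).Nodup :=
  (foldl_dedupStep l [] List.nodup_nil).1

/-- `dedupKeep l` has the members of `l`. [folklore] -/
@[simp] theorem mem_dedupKeep {l : List ℕ} {x : ℕ} : x ∈ dedupKeep l ↔ x ∈ l := by
  rw [dedupKeep, (foldl_dedupStep l [] List.nodup_nil).2.1 x]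
  simp

/-- `dedupKeep` does not lengthen. [folklore] -/
theorem length_dedupKeep_le (l : List ℕ) : (dedupKeep l).length ≤ l.length := by
  have h := (foldl_dedupStep l [] List.nodup_nil).2.2
  simpa [dedupKeep] using h

/-- Extensional comparison of index lists: same members. [folklore] -/
def sameSet (a b : List ℕ) : Bool :=
  (a.all fun k => decide (k ∈ b)) && (b.all fun k => decide (k ∈ a))

/-- `sameSet a b` iff `a` and `b` have the same members. [folklore] -/
theorem sameSet_eq_true_iff {a b : List ℕ} : sameSet a b = true ↔ ∀ k, k ∈ a ↔ k ∈ b := by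
  simp only [sameSet, Bool.and_eq_true, List.all_eq_true, decide_eq_true_eq]
  exact ⟨fun h k => ⟨h.1 k, h.2 k⟩, fun h => ⟨fun k => (h k).1, fun k => (h k).2⟩⟩

/-- **Hash-consing decides equality of sets**: in a canonical table two lists of valid indices
denote the same set iff they have the same members. [folklore] -/
theorem Canon.ofList_map_val_eq_iff {T : List (List ℕ)} (hT : Canon n T) {a b : List ℕ}
    (ha : ∀ k ∈ a, k < T.length) (hb : ∀ k ∈ b, k < T.length) :
    HF.ofList (a.map (val n T)) = HF.ofList (b.map (val n T)) ↔ ∀ k, k ∈ a ↔ k ∈ b := by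
  constructor
  · intro h k
    have key : ∀ {a b : List ℕ}, (∀ k ∈ a, k < T.length) → (∀ k ∈ b, k < T.length) →
        HF.ofList (a.map (val n T)) = HF.ofList (b.map (val n T)) → k ∈ a → k ∈ b := by
      intro a b ha hb h hk
      have hmem : val n T k ∈ HF.ofList (b.map (val n T)) := by
        rw [← h, HF.mem_ofList, List.mem_map]
        exact ⟨k, hk, rfl⟩
      rw [HF.mem_ofList, List.mem_map] at hmem
      obtain ⟨k', hk', hkk'⟩ := hmem
      rwa [← hT.inj k' k (hb k' hk') (ha k hk) hkk']
    exact ⟨key ha hb h, key hb ha h.symm⟩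
  · intro h
    refine HF.ext (HF.not_isAtom_ofList _) (HF.not_isAtom_ofList _) fun x => ?_
    simp only [HF.mem_ofList, List.mem_map]
    exact ⟨fun ⟨k, hk, hkx⟩ => ⟨k, (h k).1 hk, hkx⟩, fun ⟨k, hk, hkx⟩ => ⟨k, (h k).2 hk, hkx⟩⟩

/-! ### Lookup-or-insert -/

/-- The first SET index of `T` whose entry has the same members as `l`, if any. [folklore] -/
def findSet (n : ℕ) (T : List (List ℕ)) (l : List ℕ) : Option ℕ :=
  (List.range T.length).find? fun j => decide (n ≤ j) && sameSet (T.getD j []) l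

/-- What a successful search returns. [folklore] -/
theorem findSet_eq_some {T : List (List ℕ)} {l : List ℕ} {j : ℕ} (h : findSet n T l = some j) :
    n ≤ j ∧ j < T.length ∧ sameSet (T.getD j []) l = true := by
  have h1 := List.find?_some h
  have h2 := List.mem_of_find?_eq_some h
  simp only [Bool.and_eq_true, decide_eq_true_eq] at h1
  exact ⟨h1.1, List.mem_range.mp h2, h1.2⟩

/-- What a failed search means. [folklore] -/
theorem findSet_eq_none {T : List (List ℕ)} {l : List ℕ} (h : findSet n T l = none) {j : ℕ}
    (hnj : n ≤ j) (hj : j < T.length) : sameSet (T.getD j []) l = false := by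
  rw [findSet, List.find?_eq_none] at h
  have := h j (List.mem_range.mpr hj)
  simpa [hnj] using this

/-- **Lookup-or-insert** of the set with member indices `l`: the index of an existing entry with
the same members, or a fresh index for the appended entry `dedupKeep l`. Returns the (possibly
extended) table and the index. [folklore] -/
def mkSet (n : ℕ) (T : List (List ℕ)) (l : List ℕ) : List (List ℕ) × ℕ :=
  match findSet n T (dedupKeep l) with
  | some j => (T, j)
  | none => (T ++ [dedupKeep l], T.length)

/-- `mkSet` only appends: the old table is a prefix of the new one. [folklore] -/
theorem prefix_mkSet (n : ℕ) (T : List (List ℕ)) (l : List ℕ) : T <+: (mkSet n T l).1 := by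
  unfold mkSet
  split
  · exact List.prefix_rfl
  · exact List.prefix_append _ _

/-- The table does not shrink. [folklore] -/
theorem length_le_length_mkSet (n : ℕ) (T : List (List ℕ)) (l : List ℕ) :
    T.length ≤ (mkSet n T l).1.length :=
  (prefix_mkSet n T l).length_le

/-- The table grows by at most one entry. [folklore] -/
theorem length_mkSet_le (n : ℕ) (T : List (List ℕ)) (l : List ℕ) :
    (mkSet n T l).1.length ≤ T.length + 1 := by
  unfold mkSet
  split <;> simp

/-- The returned index is valid. [folklore] -/
theorem snd_mkSet_lt (n : ℕ) (T : List (List ℕ)) (l : List ℕ) :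
    (mkSet n T l).2 < (mkSet n T l).1.length := by
  unfold mkSet
  split
  · rename_i h
    exact (findSet_eq_some h).2.1
  · simp

/-- Old entries are unchanged. [folklore] -/
theorem getD_mkSet_of_lt (n : ℕ) (T : List (List ℕ)) (l : List ℕ) {i : ℕ} (hi : i < T.length) :
    (mkSet n T l).1.getD i [] = T.getD i [] := by
  unfold mkSet
  split
  · rfl
  · exact List.getD_append _ _ _ _ hi

/-- **Old indices keep their values.** [folklore] -/
theorem val_mkSet_of_lt (n : ℕ) (T : List (List ℕ)) (l : List ℕ) {i : ℕ} (hi : i < T.length) :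
    val n (mkSet n T l).1 i = val n T i :=
  val_of_agree (m := T.length) (fun _ hj => getD_mkSet_of_lt n T l hj) hi

/-- `elems` of old indices are unchanged. [folklore] -/
theorem elems_mkSet_of_lt (n : ℕ) (T : List (List ℕ)) (l : List ℕ) {i : ℕ} (hi : i < T.length) :
    elems n (mkSet n T l).1 i = elems n T i := by
  simp only [elems, getD_mkSet_of_lt n T l hi]

/-- The value of an appended entry of valid indices. [folklore] -/
theorem val_append_singleton {T : List (List ℕ)} (hn : n ≤ T.length) {d : List ℕ}
    (hd : ∀ k ∈ d, k < T.length) :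
    val n (T ++ [d]) T.length = HF.ofList (d.map (val n T)) := by
  rw [val_of_le _ hn, List.getD_append_right _ _ _ _ le_rfl, Nat.sub_self, List.getD_cons_zero,
    List.filter_eq_self.mpr fun k hk => decide_eq_true (hd k hk)]
  congr 1
  exact List.map_congr_left fun k hk => val_append T [d] (hd k hk)

/-- **`mkSet` is correct and preserves canonicity**: on a canonical table and valid indices `l`,
the new table is canonical and the returned index denotes `{val k : k ∈ l}`. [folklore] -/
theorem Canon.mkSet {T : List (List ℕ)} (hT : Canon n T) {l : List ℕ} (hl : ∀ k ∈ l, k < T.length) :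
    Canon n (Sim.mkSet n T l).1 ∧
      val n (Sim.mkSet n T l).1 (Sim.mkSet n T l).2 = HF.ofList (l.map (val n T)) := by
  have hle := hT.le_length
  have hd : ∀ k ∈ dedupKeep l, k < T.length := fun k hk => hl k (mem_dedupKeep.mp hk)
  have hdl : HF.ofList ((dedupKeep l).map (val n T)) = HF.ofList (l.map (val n T)) :=
    (hT.ofList_map_val_eq_iff hd hl).mpr fun k => mem_dedupKeep
  unfold Sim.mkSet
  split
  · -- found an entry with the same members
    rename_i j hj
    obtain ⟨hnj, hjT, hsame⟩ := findSet_eq_some hj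
    refine ⟨hT, ?_⟩
    dsimp only
    rw [hT.val_eq hnj hjT, ← hdl]
    exact (hT.ofList_map_val_eq_iff (fun k hk => (hT.wf j hnj hjT k hk).trans hjT) hd).mpr
      (sameSet_eq_true_iff.mp hsame)
  · -- append a fresh entry
    rename_i hnone
    have hnew : val n (T ++ [dedupKeep l]) T.length = HF.ofList (l.map (val n T)) := by
      rw [val_append_singleton (by omega) hd, hdl]
    refine ⟨⟨?_, ?_, ?_, ?_, ?_, ?_⟩, hnew⟩
    · simp; omega
    · intro i hni hi k hk
      simp only [List.length_append, List.length_singleton] at hi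
      rcases Nat.lt_succ_iff_lt_or_eq.mp hi with hi | rfl
      · rw [List.getD_append _ _ _ _ hi] at hk
        exact hT.wf i hni hi k hk
      · rw [List.getD_append_right _ _ _ _ le_rfl, Nat.sub_self, List.getD_cons_zero] at hk
        exact hd k hk
    · intro i hni hi
      simp only [List.length_append, List.length_singleton] at hi
      rcases Nat.lt_succ_iff_lt_or_eq.mp hi with hi | rfl
      · rw [List.getD_append _ _ _ _ hi]
        exact hT.nodup i hni hi
      · rw [List.getD_append_right _ _ _ _ le_rfl, Nat.sub_self, List.getD_cons_zero]
        exact nodup_dedupKeep l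
    · -- injectivity: a clash with an old index would have been found by `findSet`
      have hclash : ∀ i, i < T.length → val n T i ≠ HF.ofList (l.map (val n T)) := by
        intro i hi h
        have hni : n ≤ i := by
          by_contra hlt
          have hat : (val n T i).IsAtom := (isAtom_val_iff T i).mpr (Nat.lt_of_not_le hlt)
          rw [h] at hat
          exact HF.not_isAtom_ofList _ hat
        rw [hT.val_eq hni hi, ← hdl] at h
        have hsame : sameSet (T.getD i []) (dedupKeep l) = true :=
          sameSet_eq_true_iff.mpr ((hT.ofList_map_val_eq_iff
            (fun k hk => (hT.wf i hni hi k hk).trans hi) hd).mp h)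
        rw [findSet_eq_none hnone hni hi] at hsame
        exact Bool.false_ne_true hsame
      intro i j hi hj h
      simp only [List.length_append, List.length_singleton] at hi hj
      rcases Nat.lt_succ_iff_lt_or_eq.mp hi with hi | rfl <;>
        rcases Nat.lt_succ_iff_lt_or_eq.mp hj with hj | rfl
      · rw [val_append T _ hi, val_append T _ hj] at h
        exact hT.inj i j hi hj h
      · rw [val_append T _ hi, hnew] at h
        exact (hclash i hi h).elim
      · rw [val_append T _ hj, hnew] at h
        exact (hclash j hj h.symm).elim
      · rfl
    · rw [List.getD_append _ _ _ _ (by omega)]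
      exact hT.entry_n
    · rw [List.getD_append _ _ _ _ (by omega)]
      exact hT.entry_n_succ

/-- Canonicity is preserved by `mkSet`. [folklore] -/
theorem Canon.canon_mkSet {T : List (List ℕ)} (hT : Canon n T) {l : List ℕ}
    (hl : ∀ k ∈ l, k < T.length) : Canon n (Sim.mkSet n T l).1 :=
  (hT.mkSet hl).1

/-- The index returned by `mkSet` denotes `{val k : k ∈ l}`. [folklore] -/
theorem Canon.val_mkSet {T : List (List ℕ)} (hT : Canon n T) {l : List ℕ}
    (hl : ∀ k ∈ l, k < T.length) :
    val n (Sim.mkSet n T l).1 (Sim.mkSet n T l).2 = HF.ofList (l.map (val n T)) :=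
  (hT.mkSet hl).2

/-- Membership in the set made by `mkSet`. [folklore] -/
theorem Canon.mem_val_mkSet {T : List (List ℕ)} (hT : Canon n T) {l : List ℕ}
    (hl : ∀ k ∈ l, k < T.length) (x : HF (Fin n)) :
    x ∈ val n (Sim.mkSet n T l).1 (Sim.mkSet n T l).2 ↔ ∃ k ∈ l, val n T k = x := by
  rw [hT.val_mkSet hl, HF.mem_ofList, List.mem_map]

/-- The set made by `mkSet` has as many members as `l` has distinct entries. [folklore] -/
theorem Canon.length_elems_mkSet {T : List (List ℕ)} (hT : Canon n T) {l : List ℕ}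
    (hl : ∀ k ∈ l, k < T.length) :
    (elems n (Sim.mkSet n T l).1 (Sim.mkSet n T l).2).length = (dedupKeep l).length := by
  classical
  have hT' := hT.canon_mkSet hl
  rw [← hT'.card_members_val (snd_mkSet_lt n T l)]
  have hset : (val n (Sim.mkSet n T l).1 (Sim.mkSet n T l).2).members =
      ((dedupKeep l).map (val n T)).toFinset := by
    ext x
    rw [HF.mem_members, hT.mem_val_mkSet hl, List.mem_toFinset, List.mem_map]
    simp only [mem_dedupKeep]
  rw [hset, List.toFinset_card_of_nodup, List.length_map]
  refine (List.nodup_map_iff_inj_on (nodup_dedupKeep l)).mpr fun k hk k' hk' h => ?_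
  exact hT.inj k k' (hl k (mem_dedupKeep.mp hk)) (hl k' (mem_dedupKeep.mp hk')) h

/-! ### The initial table -/

/-- The initial table: the `n` atoms, then `∅ = 0` and `{∅} = 1`. [folklore] -/
def initTab (n : ℕ) : List (List ℕ) := List.replicate n [] ++ [[], [n]]

/-- The initial table has `n + 2` entries. [folklore] -/
@[simp] theorem length_initTab (n : ℕ) : (initTab n).length = n + 2 := by
  simp [initTab]

/-- Entry `n` of the initial table. [folklore] -/
theorem getD_initTab_n (n : ℕ) : (initTab n).getD n [] = [] := by
  rw [initTab, List.getD_append_right _ _ _ _ (by simp), List.length_replicate, Nat.sub_self]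
  rfl

/-- Entry `n + 1` of the initial table. [folklore] -/
theorem getD_initTab_n_succ (n : ℕ) : (initTab n).getD (n + 1) [] = [n] := by
  rw [initTab, List.getD_append_right _ _ _ _ (by simp), List.length_replicate,
    Nat.add_sub_cancel_left]
  rfl

/-- The set entries of the initial table. [folklore] -/
theorem getD_initTab_of_le {n i : ℕ} (hni : n ≤ i) (hi : i < n + 2) :
    (initTab n).getD i [] = if i = n then [] else [n] := by
  rcases Nat.lt_succ_iff_lt_or_eq.mp hi with hi | rfl
  · obtain rfl : i = n := by omega
    rw [if_pos rfl, getD_initTab_n]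
  · rw [if_neg (by omega), getD_initTab_n_succ]

/-- Index `n` of the initial table denotes `∅`. [folklore] -/
theorem val_initTab_n (n : ℕ) : val n (initTab n) n = ∅ := by
  rw [val_of_le _ le_rfl, getD_initTab_n]
  exact HF.eq_empty_of_forall_not_mem (HF.not_isAtom_ofList _) fun x hx => by simp at hx

/-- Index `n + 1` of the initial table denotes `{∅} = 1`. [folklore] -/
theorem val_initTab_n_succ (n : ℕ) : val n (initTab n) (n + 1) = HF.ofBool true := by
  rw [val_of_le _ (Nat.le_succ n), getD_initTab_n_succ, HF.ofBool_true]
  have hf : List.filter (fun k => decide (k < n + 1)) [n] = [n] := by simp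
  rw [hf, List.map_singleton, val_initTab_n]
  refine HF.ext (HF.not_isAtom_ofList _) (HF.not_isAtom_ordinal 1) fun x => ?_
  rw [HF.mem_ofList, List.mem_singleton, HF.mem_ordinal_iff]
  constructor
  · rintro rfl
    exact ⟨0, Nat.zero_lt_one, rfl⟩
  · rintro ⟨m, hm, rfl⟩
    obtain rfl : m = 0 := Nat.lt_one_iff.mp hm
    rfl

/-- **The initial table is canonical.** [folklore] -/
theorem canon_initTab (n : ℕ) : Canon n (initTab n) := by
  refine ⟨by simp, ?_, ?_, ?_, getD_initTab_n n, getD_initTab_n_succ n⟩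
  · intro i hni hi k hk
    rw [length_initTab] at hi
    rw [getD_initTab_of_le hni hi] at hk
    split_ifs at hk with h
    · simp at hk
    · rw [List.mem_singleton] at hk
      omega
  · intro i hni hi
    rw [length_initTab] at hi
    rw [getD_initTab_of_le hni hi]
    split_ifs <;> simp
  · -- injectivity: atoms are distinct atoms, `n ↦ ∅`, `n + 1 ↦ {∅}`
    have hval : ∀ i, n ≤ i → i < n + 2 →
        val n (initTab n) i = if i = n then (∅ : HF (Fin n)) else HF.ofBool true := by
      intro i hni hi
      rcases Nat.lt_succ_iff_lt_or_eq.mp hi with hi | rfl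
      · obtain rfl : i = n := by omega
        rw [if_pos rfl, val_initTab_n]
      · rw [if_neg (by omega), val_initTab_n_succ]
    intro i j hi hj h
    rw [length_initTab] at hi hj
    by_cases hin : i < n <;> by_cases hjn : j < n
    · rw [val_of_lt _ hin, val_of_lt _ hjn] at h
      exact Fin.mk.inj_iff.mp (HF.atom_injective h)
    · have hat : (val n (initTab n) j).IsAtom := h ▸ (isAtom_val_iff _ i).mpr hin
      exact absurd ((isAtom_val_iff _ j).mp hat) hjn
    · have hat : (val n (initTab n) i).IsAtom := h.symm ▸ (isAtom_val_iff _ j).mpr hjn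
      exact absurd ((isAtom_val_iff _ i).mp hat) hin
    · rw [hval i (Nat.le_of_not_lt hin) hi, hval j (Nat.le_of_not_lt hjn) hj] at h
      by_contra hne
      have h01 : (∅ : HF (Fin n)) ≠ HF.ofBool true := by
        rw [HF.ofBool_true]; exact HF.empty_ne_ordinal_succ 0
      split_ifs at h with h1 h2 h2
      · omega
      · exact h01 h
      · exact h01 h.symm
      · omega

/-- Atoms denote atoms, in the initial table as in any table. [folklore] -/
theorem val_initTab_atom (a : Fin n) : val n (initTab n) a = HF.atom a := val_of_lt _ a.2

end Literature.ModelTheory.FiniteModelTheory.BGS.Sim
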